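import Summits.HubbardSuperconductivity.HubbardLadder.Bounds.TracePathExpansion
import HarnessLib

/-!
# Word expansion of Euler products and the covering-word count

HONEST FRAMING (cell pub-hubbard): ladder R1–R4 with certified numbers; no claim on H/H₀. Bounds for
model classes (a counting lemma for the activity bound of Hubbard-type polymer expansions), no
materials claim. Generic; imports part 1 (`TracePathExpansion`) only.

Two elementary ingredients of the Hölder-type activity bound (`EulerActivityBound`):

1. WORD EXPANSION (`listProd_ofFn_sum_smul`): an ordered product of `N` sums `Σ_a x_k(a) • A_k(a)`
   is the sum over words `f : Fin N → ι` of `(∏_k x_k(f k)) • ∏_k A_k(f k)` (the matrix instance of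
   `Literature.…QuantumLattice.HubbardInteractionMoments.prod_ofFn_sum_smul`, restated here to avoid
   that module's heavy import closure).

2. COVERING-WORD COUNT (`coverSum_le`): for letter weights `1` (the diagonal letter `none`) and
   `y_b ≥ 0` (bond letters `some b`), the total weight of the words of length `N` whose set of bond
   letters is EXACTLY `K` satisfies
   `coverSum y N K = Σ_{f : used f = K} ∏_k wt(f k) ≤ ∏_{b ∈ K} (e^{N y_b} - 1)`,
   by the recursion `coverSum (N+1) K ≤ (1 + y_K) coverSum N K + Σ_{b∈K} y_b coverSum N (K - b)`
   (first letter: diagonal, a bond already used later, or the last use of a bond) and the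
   elementary `(1 + y_K) ∏_K u + Σ_b y_b ∏_{K-b} u ≤ ∏_K ((1+y_b) u_b + y_b) ≤ ∏_K (e^{y_b}(u_b+1) - 1)`.
   With `y_b = |c_b|/N` the right side is `∏_{b∈K} (e^{|c_b|} - 1)` for every `N` — the constant of
   `bounds.tex` Lemma 12.2 (Hölder form), obtained here by counting instead of Hölder's inequality.

References: D. Ueltschi, J. Stat. Phys. 95 (1999) 693, §2.3 [Ueltschi1999] (the bound
`∏(e^{|c_b|}-1)` via Duhamel/Hölder); folklore combinatorics.
-/

namespace Summit.HubbardSuperconductivity.HubbardLadder.Bounds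

open Matrix Finset

/-! ### Word expansion of an ordered product of sums -/

section WordExpansion

variable {n : Type*} [Fintype n] [DecidableEq n] {R : Type*} [CommRing R] {ι : Type*} [Fintype ι]

/-- `∏_k (Σ_a x_k(a) • A_k(a)) = Σ_f (∏_k x_k(f k)) • ∏_k A_k(f k)` (ordered products over `Fin N`).
[folklore] -/
theorem listProd_ofFn_sum_smul : ∀ (N : ℕ) (x : Fin N → ι → R) (A : Fin N → ι → Matrix n n R),
    (List.ofFn fun k => ∑ a, x k a • A k a).prod =
      ∑ f : Fin N → ι, (∏ k, x k (f k)) • (List.ofFn fun k => A k (f k)).prod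
  | 0, x, A => by simp
  | N + 1, x, A => by
    rw [List.ofFn_succ, List.prod_cons, listProd_ofFn_sum_smul N (fun k => x k.succ) fun k => A k.succ,
      Finset.sum_mul_sum,
      Fintype.sum_equiv (Fin.consEquiv fun _ : Fin (N + 1) => ι).symm
        (fun f : Fin (N + 1) → ι => (∏ k, x k (f k)) • (List.ofFn fun k => A k (f k)).prod)
        (fun p => (x 0 p.1 • A 0 p.1) *
          ((∏ k : Fin N, x k.succ (p.2 k)) • (List.ofFn fun k : Fin N => A k.succ (p.2 k)).prod))
        (fun f => by
          rw [show (Fin.consEquiv fun _ : Fin (N + 1) => ι).symm f = (f 0, Fin.tail f) from rfl]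
          dsimp only [Fin.tail]
          rw [Fin.prod_univ_succ, List.ofFn_succ, List.prod_cons, Matrix.smul_mul, Matrix.mul_smul,
            smul_smul]),
      Fintype.sum_prod_type]

end WordExpansion

/-! ### Covering words -/

section Counting

variable {α : Type*} [Fintype α] [DecidableEq α]

/-- The set of bond letters used by a word. -/
def usedSet {N : ℕ} (f : Fin N → Option α) : Finset α := Finset.univ.filter fun b => ∃ k, f k = some b

/-- Auxiliary lemma `mem_usedSet` (support step for the results of this file; see the module docstring). -/
theorem mem_usedSet {N : ℕ} {f : Fin N → Option α} {b : α} : b ∈ usedSet f ↔ ∃ k, f k = some b := by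
  simp [usedSet]

/-- Auxiliary lemma `usedSet_zero` (support step for the results of this file; see the module docstring). -/
theorem usedSet_zero (f : Fin 0 → Option α) : usedSet f = ∅ := by
  ext b; simp [mem_usedSet]

/-- Auxiliary lemma `usedSet_cons` (support step for the results of this file; see the module docstring). -/
theorem usedSet_cons {N : ℕ} (a : Option α) (g : Fin N → Option α) :
    usedSet (Fin.cons a g : Fin (N + 1) → Option α) = a.toFinset ∪ usedSet g := by
  ext b
  simp only [mem_usedSet, Finset.mem_union, Option.mem_toFinset, Option.mem_def, Fin.exists_fin_succ,
    Fin.cons_zero, Fin.cons_succ]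

/-- Letter weights: `1` for the diagonal letter, `y b` for the bond letter `b`. -/
def letterWt (y : α → ℝ) : Option α → ℝ := fun a => a.elim 1 y

omit [Fintype α] [DecidableEq α] in
/-- Auxiliary lemma `letterWt_none` (support step for the results of this file; see the module docstring). -/
@[simp] theorem letterWt_none (y : α → ℝ) : letterWt y none = 1 := by simp [letterWt]

omit [Fintype α] [DecidableEq α] in
/-- Auxiliary lemma `letterWt_some` (support step for the results of this file; see the module docstring). -/
@[simp] theorem letterWt_some (y : α → ℝ) (b : α) : letterWt y (some b) = y b := by simp [letterWt]

omit [Fintype α] [DecidableEq α] in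
/-- Auxiliary lemma `letterWt_nonneg` (support step for the results of this file; see the module docstring). -/
theorem letterWt_nonneg {y : α → ℝ} (hy : ∀ b, 0 ≤ y b) (a : Option α) : 0 ≤ letterWt y a := by
  cases a <;> simp [hy]

/-- Total weight of the words of length `N` whose bond letters are exactly `K`. -/
def coverSum (y : α → ℝ) (N : ℕ) (K : Finset α) : ℝ :=
  ∑ f : Fin N → Option α, if usedSet f = K then ∏ k, letterWt y (f k) else 0

/-- Auxiliary lemma `coverSum_nonneg` (support step for the results of this file; see the module docstring). -/
theorem coverSum_nonneg {y : α → ℝ} (hy : ∀ b, 0 ≤ y b) (N : ℕ) (K : Finset α) :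
    0 ≤ coverSum y N K :=
  Finset.sum_nonneg fun f _ => by
    split_ifs
    · exact Finset.prod_nonneg fun k _ => letterWt_nonneg hy _
    · exact le_rfl

/-- Auxiliary lemma `coverSum_zero` (support step for the results of this file; see the module docstring). -/
theorem coverSum_zero (y : α → ℝ) (K : Finset α) : coverSum y 0 K = if K = ∅ then 1 else 0 := by
  unfold coverSum
  rw [Fintype.sum_unique]
  simp only [usedSet_zero, Finset.univ_eq_empty, Finset.prod_empty]
  by_cases hK : K = ∅
  · simp [hK]
  · rw [if_neg hK, if_neg (Ne.symm hK)]

/-- **Recursion** (an inequality suffices): splitting off the first letter. [folklore] -/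
theorem coverSum_succ_le {y : α → ℝ} (hy : ∀ b, 0 ≤ y b) (N : ℕ) (K : Finset α) :
    coverSum y (N + 1) K ≤
      (1 + ∑ b ∈ K, y b) * coverSum y N K + ∑ b ∈ K, y b * coverSum y N (K.erase b) := by
  unfold coverSum
  rw [Fintype.sum_equiv (Fin.consEquiv fun _ : Fin (N + 1) => Option α).symm _
      (fun p => if usedSet (Fin.cons p.1 p.2 : Fin (N + 1) → Option α) = K then
        letterWt y p.1 * ∏ k, letterWt y (p.2 k) else 0)
      (fun f => by
        rw [show (Fin.consEquiv fun _ : Fin (N + 1) => Option α).symm f = (f 0, Fin.tail f) from rfl]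
        dsimp only [Fin.tail]
        rw [Fin.cons_self_tail, Fin.prod_univ_succ]),
    Fintype.sum_prod_type, Fintype.sum_option]
  simp only [usedSet_cons, Option.toFinset_none, Option.toFinset_some, Finset.empty_union,
    letterWt_none, letterWt_some, one_mul]
  set S : Finset α → ℝ := fun K' => ∑ g : Fin N → Option α,
    if usedSet g = K' then ∏ k, letterWt y (g k) else 0 with hS
  have hS0 : ∀ K', 0 ≤ S K' := fun K' => coverSum_nonneg hy N K'
  have h2 : ∀ b, (∑ g : Fin N → Option α,
      if {b} ∪ usedSet g = K then y b * ∏ k, letterWt y (g k) else 0) ≤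
        if b ∈ K then y b * (S K + S (K.erase b)) else 0 := by
    intro b
    split_ifs with hb
    · rw [hS]
      dsimp only
      rw [← Finset.sum_add_distrib, Finset.mul_sum]
      refine Finset.sum_le_sum fun g _ => ?_
      have hw : 0 ≤ ∏ k, letterWt y (g k) := Finset.prod_nonneg fun k _ => letterWt_nonneg hy _
      have hyb := hy b
      by_cases hU : {b} ∪ usedSet g = K
      · rw [if_pos hU]
        by_cases hbU : b ∈ usedSet g
        · have hUK : usedSet g = K := by
            rw [← hU, eq_comm, Finset.union_eq_right]
            exact Finset.singleton_subset_iff.2 hbU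
          rw [if_pos hUK]
          split_ifs <;> nlinarith
        · have hUK : usedSet g = K.erase b := by
            rw [← hU]
            ext x
            simp only [Finset.mem_erase, Finset.mem_union, Finset.mem_singleton]
            constructor
            · intro hx
              exact ⟨fun h => hbU (h ▸ hx), Or.inr hx⟩
            · rintro ⟨hne, h | hx⟩
              · exact absurd h hne
              · exact hx
          rw [if_pos hUK]
          split_ifs <;> nlinarith
      · rw [if_neg hU]
        split_ifs <;> nlinarith
    · refine (Finset.sum_eq_zero fun g _ => ?_).le
      rw [if_neg]
      intro h
      exact hb (h ▸ Finset.mem_union_left _ (Finset.mem_singleton_self b))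
  have h3 : ∑ b, (∑ g : Fin N → Option α,
      if {b} ∪ usedSet g = K then y b * ∏ k, letterWt y (g k) else 0) ≤
        ∑ b ∈ K, y b * (S K + S (K.erase b)) := by
    refine (Finset.sum_le_sum fun b _ => h2 b).trans (le_of_eq ?_)
    rw [Finset.sum_ite_mem, Finset.univ_inter]
  refine (add_le_add le_rfl h3).trans (le_of_eq ?_)
  simp only [hS, mul_add, Finset.sum_add_distrib, ← Finset.sum_mul]
  ring

omit [Fintype α] in
/-- **The product step**: for `y, u ≥ 0`,
`(1 + Σ_K y) ∏_K u + Σ_{b∈K} y_b ∏_{K-b} u ≤ ∏_K ((1 + y_b) u_b + y_b)`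
(keep the terms of `∏ (y + (1+y)u)` with at most one factor `y`). [folklore] -/
theorem sum_prod_erase_le_prod {y u : α → ℝ} (hy : ∀ b, 0 ≤ y b) (hu : ∀ b, 0 ≤ u b) (K : Finset α) :
    (1 + ∑ b ∈ K, y b) * ∏ b ∈ K, u b + ∑ b ∈ K, y b * ∏ b' ∈ K.erase b, u b' ≤
      ∏ b ∈ K, ((1 + y b) * u b + y b) := by
  have hexp : ∏ b ∈ K, ((1 + y b) * u b + y b) =
      ∑ t ∈ K.powerset, (∏ b ∈ t, y b) * ∏ b ∈ K \ t, (1 + y b) * u b := by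
    rw [← Finset.prod_add]
    exact Finset.prod_congr rfl fun b _ => by ring
  rw [hexp]
  have hg0 : ∀ b, 0 ≤ (1 + y b) * u b := fun b => mul_nonneg (by linarith [hy b]) (hu b)
  have hterm0 : ∀ t ∈ K.powerset, 0 ≤ (∏ b ∈ t, y b) * ∏ b ∈ K \ t, (1 + y b) * u b :=
    fun t _ => mul_nonneg (Finset.prod_nonneg fun b _ => hy b) (Finset.prod_nonneg fun b _ => hg0 b)
  -- the sub-family `{∅} ∪ {{b} : b ∈ K}`
  set F : Finset (Finset α) := insert ∅ (K.map ⟨fun b => ({b} : Finset α), Finset.singleton_injective⟩)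
    with hF
  have hFsub : F ⊆ K.powerset := by
    intro t ht
    rcases Finset.mem_insert.1 ht with rfl | ht
    · exact Finset.empty_mem_powerset K
    · obtain ⟨b, hb, rfl⟩ := Finset.mem_map.1 ht
      exact Finset.mem_powerset.2 (Finset.singleton_subset_iff.2 hb)
  have hnot : (∅ : Finset α) ∉ K.map ⟨fun b => ({b} : Finset α), Finset.singleton_injective⟩ := by
    intro h
    obtain ⟨b, _, hb⟩ := Finset.mem_map.1 h
    exact Finset.singleton_ne_empty b hb
  refine le_trans ?_ (Finset.sum_le_sum_of_subset_of_nonneg hFsub fun t ht _ => hterm0 t ht)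
  rw [hF, Finset.sum_insert hnot, Finset.sum_map]
  simp only [Function.Embedding.coeFn_mk, Finset.prod_empty, one_mul, Finset.sdiff_empty,
    Finset.prod_singleton, Finset.sdiff_singleton_eq_erase]
  refine add_le_add ?_ (Finset.sum_le_sum fun b hb => mul_le_mul_of_nonneg_left ?_ (hy b))
  · rw [Finset.prod_mul_distrib]
    -- `1 + Σ_K y ≤ ∏_K (1 + y)` for `y ≥ 0` (folklore, kept local: the tree has several
    -- namespace-local copies of this inequality)
    have h1 : ∀ K : Finset α, 1 + ∑ b ∈ K, y b ≤ ∏ b ∈ K, (1 + y b) := fun K => by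
      induction K using Finset.induction_on with
      | empty => simp
      | insert a K ha ih =>
        rw [Finset.sum_insert ha, Finset.prod_insert ha]
        have hK : 0 ≤ ∑ b ∈ K, y b := Finset.sum_nonneg fun b _ => hy b
        nlinarith [hy a, ih]
    exact mul_le_mul_of_nonneg_right (h1 K) (Finset.prod_nonneg fun b _ => hu b)
  · exact Finset.prod_le_prod (fun b _ => hu b) fun b' _ => by nlinarith [hy b', hu b']

/-- **THEOREM (covering-word count).** For `y ≥ 0`:
`coverSum y N K ≤ ∏_{b∈K} (e^{N y_b} - 1)`. [folklore] -/
theorem coverSum_le {y : α → ℝ} (hy : ∀ b, 0 ≤ y b) (N : ℕ) :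
    ∀ K : Finset α, coverSum y N K ≤ ∏ b ∈ K, (Real.exp (N * y b) - 1) := by
  induction N with
  | zero =>
    intro K
    rw [coverSum_zero]
    split_ifs with hK
    · simp [hK]
    · obtain ⟨b, hb⟩ := Finset.nonempty_iff_ne_empty.2 hK
      rw [Finset.prod_eq_zero hb (by simp)]
  | succ N ih =>
    intro K
    have hu : ∀ b, 0 ≤ Real.exp (N * y b) - 1 := fun b => by
      have : 0 ≤ (N : ℝ) * y b := mul_nonneg (Nat.cast_nonneg N) (hy b)
      linarith [Real.add_one_le_exp ((N : ℝ) * y b)]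
    have hyK : 0 ≤ 1 + ∑ b ∈ K, y b := by linarith [Finset.sum_nonneg fun b (_ : b ∈ K) => hy b]
    calc coverSum y (N + 1) K
        ≤ (1 + ∑ b ∈ K, y b) * coverSum y N K + ∑ b ∈ K, y b * coverSum y N (K.erase b) :=
          coverSum_succ_le hy N K
      _ ≤ (1 + ∑ b ∈ K, y b) * ∏ b ∈ K, (Real.exp (N * y b) - 1) +
            ∑ b ∈ K, y b * ∏ b' ∈ K.erase b, (Real.exp (N * y b') - 1) :=
          add_le_add (mul_le_mul_of_nonneg_left (ih K) hyK)
            (Finset.sum_le_sum fun b _ => mul_le_mul_of_nonneg_left (ih _) (hy b))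
      _ ≤ ∏ b ∈ K, ((1 + y b) * (Real.exp (N * y b) - 1) + y b) := sum_prod_erase_le_prod hy hu K
      _ ≤ ∏ b ∈ K, (Real.exp ((N + 1 : ℕ) * y b) - 1) := by
          refine Finset.prod_le_prod (fun b _ => by nlinarith [hy b, hu b]) fun b _ => ?_
          have h1 := Real.add_one_le_exp (y b)
          have h2 : Real.exp ((N + 1 : ℕ) * y b) = Real.exp (N * y b) * Real.exp (y b) := by
            rw [← Real.exp_add]; push_cast; ring_nf
          rw [h2]
          nlinarith [hu b, hy b, Real.exp_pos (N * y b)]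

end Counting

end Summit.HubbardSuperconductivity.HubbardLadder.Bounds
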